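import Mathlib
import HarnessLib
import Summits.CriticalPhenomena.PercolationContinuityZ3.Theses.PercShatteringRace

/-!
# Sketch (ideator 3, gen 2) — card `single-edge-doors-flux-balance` for crux stmt-CriticalPhenomena-5785

First-lemma signatures only (they must elaborate; nothing is proved here except the read-back
`crux_iff`).  Fixed-`p` edge-flip FLUX IDENTITIES between the level sets `{N = k}` of the number
`N` of shell-crossing clusters, and the "door bound" they give for non-proliferation at one aspect.
-/

namespace Summit.CriticalPhenomena.PercolationContinuityZ3.Cruxes.NearLinearTwoClusterDecay.SketchDoors

open MeasureTheory Filter Topology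
open Literature.Probability.LatticeModels Literature.Probability.Percolation
open Summit.CriticalPhenomena.PercolationContinuityZ3.Theses.PercShatteringRace

noncomputable section

/-- Critical bond percolation on `ℤ³`. -/
abbrev Pc : Measure (BondConfig (Site 3)) := bondPercolation (zdGraph 3) (criticalProbI 3)

/-- `p_c` as a real number. -/
abbrev pc : ℝ := ((criticalProbI 3 : unitInterval) : ℝ)

/-- The sphere `{‖x‖∞ = r}`. -/
abbrev sphere (r : ℕ) : Finset (Site 3) := innerBoundary (zdGraph 3) (box 3 r)

/-- The closed shell `S(r,R) = {r ≤ ‖x‖∞ ≤ R}`. -/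
def shell (r R : ℕ) : Set (Site 3) :=
  (↑(box 3 R) : Set (Site 3)) \ ((↑(box 3 r) : Set (Site 3)) \ ↑(sphere r))

/-- Lattice edges of the shell graph (both endpoints in the shell). -/
def shellEdges (r R : ℕ) : Set (Sym2 (Site 3)) :=
  {e | e ∈ (zdGraph 3).edgeSet ∧ ∀ v ∈ e, v ∈ shell r R}

/-- `x ∈ ∂Λ_r` is a CROSSING POINT of `ω`: its shell cluster reaches the outer sphere. -/
def IsCrossPt (r R : ℕ) (ω : BondConfig (Site 3)) (x : Site 3) : Prop :=
  x ∈ sphere r ∧ ∃ y ∈ sphere R, ω ∈ openConnIn (shell r R) x y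

/-- `{N = k}`: the shell configuration has EXACTLY `k` crossing clusters (clusters of the shell's
open graph meeting both spheres): `k` pairwise shell-disconnected crossing points which absorb
every crossing point. -/
def ExactCross (r R k : ℕ) : Set (BondConfig (Site 3)) :=
  {ω | ∃ x : Fin k → Site 3, (∀ i, IsCrossPt r R ω (x i)) ∧
      (∀ i j, i ≠ j → ω ∉ openConnIn (shell r R) (x i) (x j)) ∧
      ∀ x', IsCrossPt r R ω x' → ∃ i, ω ∈ openConnIn (shell r R) x' (x i)}

/-- The route's shell two-cluster event `B(r,R) = {N ≥ 2}` (as in the ideator-3 sketch of gen 1). -/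
def TwoShellClusters (r R : ℕ) : Set (BondConfig (Site 3)) :=
  {ω | ∃ x ∈ sphere r, ∃ x' ∈ sphere r, ∃ y ∈ sphere R, ∃ y' ∈ sphere R,
      ω ∈ openConnIn (shell r R) x y ∧ ω ∈ openConnIn (shell r R) x' y' ∧
        ω ∉ openConnIn (shell r R) x x'}

/-- `NP_M` (gen-1 sketch): at ONE bounded aspect `M`, `P(N(r,Mr) ≥ 2) ≤ 1 - c` for all large `r`. -/
def NonProliferation (M : ℕ) : Prop :=
  ∃ c : ℝ, 0 < c ∧ ∃ r₀ : ℕ, ∀ r : ℕ, r₀ ≤ r → Pc.real (TwoShellClusters r (M * r)) ≤ 1 - c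

/-- DOORS of `ω ∈ {N = k}` (`k ≥ 2`): closed shell edges whose opening lowers `N` by one — exactly the
lattice CONTACTS between two distinct crossing clusters. -/
def doors (r R k : ℕ) (ω : BondConfig (Site 3)) : Set (Sym2 (Site 3)) :=
  {e | e ∈ shellEdges r R ∧ e ∉ ω ∧ insert e ω ∈ ExactCross r R (k - 1)}

/-- SPLITTING BRIDGES of `ω' ∈ {N = k-1}`: open shell edges whose closing raises `N` by one (an open
cut-edge of a crossing cluster both of whose sides still cross). -/
def splitBridges (r R k : ℕ) (ω' : BondConfig (Site 3)) : Set (Sym2 (Site 3)) :=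
  {b | b ∈ shellEdges r R ∧ b ∈ ω' ∧ ω' \ {b} ∈ ExactCross r R k}

/-- `K_k(ω)` = number of doors. -/
def numDoors (r R k : ℕ) (ω : BondConfig (Site 3)) : ℕ := (doors r R k ω).ncard

/-- `B_k(ω')` = number of splitting bridges. -/
def numSplit (r R k : ℕ) (ω' : BondConfig (Site 3)) : ℕ := (splitBridges r R k ω').ncard

/-- FIRST LEMMA — the FLUX IDENTITY (detailed balance of single-edge flips at fixed `p = p_c`) between
`{N = k}` and `{N = k-1}`, `k ≥ 2`:  `(1 - p) · E[B_k ; N = k-1] = p · E[K_k ; N = k]`.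
(The map `(ω, e) ↦ (insert e ω, e)` is a bijection from `{(ω, e) : N(ω) = k, e ∈ doors ω}` onto
`{(ω', b) : N(ω') = k-1, b ∈ splitBridges ω'}` multiplying `Pc`-weights by `p/(1-p)`; both events
depend on the finitely many shell edges. Grimmett 1999 (2.29): "`{e pivotal}` is independent of
the state of `e`".) Provable now. -/
def FluxIdentity : Prop :=
  ∀ r R k : ℕ, 1 ≤ r → r < R → 2 ≤ k →
    (1 - pc) * ∫ ω in ExactCross r R (k - 1), (numSplit r R k ω : ℝ) ∂Pc =
      pc * ∫ ω in ExactCross r R k, (numDoors r R k ω : ℝ) ∂Pc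

/-- The FIBRE WEIGHT of `ω' ∈ {N = k-1}`: `F_k(ω') = Σ_{b ∈ splitBridges ω'} 1 / K_k(ω' ∖ b)` — each
splitting bridge weighted by the reciprocal of the number of doors of the configuration it came from. -/
def fibreWeight (r R k : ℕ) (ω' : BondConfig (Site 3)) : ℝ :=
  ∑ᶠ b ∈ splitBridges r R k ω', (1 : ℝ) / (numDoors r R k (ω' \ {b}) : ℝ)

/-- Door-averaged fibre weight seen from `ω ∈ {N = k}` with at least one door:
`(1/K_k(ω)) Σ_{e ∈ doors ω} F_k(insert e ω)`. -/
def avgFibre (r R k : ℕ) (ω : BondConfig (Site 3)) : ℝ :=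
  (∑ᶠ e ∈ doors r R k ω, fibreWeight r R k (insert e ω)) / (numDoors r R k ω : ℝ)

/-- Weighted flux identities (same bijection, weights `1/K_k(ω)` resp. `F_k(ω')/K_k(ω'∖b)`):
`(1-p) E[F_k ; N=k-1] = p P(N = k, K_k ≥ 1)` and `(1-p) E[F_k² ; N=k-1] = p E[avgFibre_k ; N=k, K_k ≥ 1]`.
Provable now. -/
def WeightedFluxIdentities : Prop :=
  ∀ r R k : ℕ, 1 ≤ r → r < R → 2 ≤ k →
    (1 - pc) * ∫ ω in ExactCross r R (k - 1), fibreWeight r R k ω ∂Pc =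
        pc * Pc.real (ExactCross r R k ∩ {ω | 1 ≤ numDoors r R k ω}) ∧
    (1 - pc) * ∫ ω in ExactCross r R (k - 1), (fibreWeight r R k ω) ^ 2 ∂Pc =
        pc * ∫ ω in ExactCross r R k ∩ {ω | 1 ≤ numDoors r R k ω}, avgFibre r R k ω ∂Pc

/-- The DOOR BOUND (Cauchy–Schwarz on the two weighted identities):
`P(N = k-1) ≥ P(N = k-1, F_k > 0) ≥ (p/(1-p)) · P(N = k, K_k ≥ 1)² / E[avgFibre_k ; N = k, K_k ≥ 1]`.
Provable now from `WeightedFluxIdentities`. -/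
def DoorBound : Prop :=
  ∀ r R k : ℕ, 1 ≤ r → r < R → 2 ≤ k →
    0 < ∫ ω in ExactCross r R k ∩ {ω | 1 ≤ numDoors r R k ω}, avgFibre r R k ω ∂Pc →
    pc / (1 - pc) * Pc.real (ExactCross r R k ∩ {ω | 1 ≤ numDoors r R k ω}) ^ 2 /
        (∫ ω in ExactCross r R k ∩ {ω | 1 ≤ numDoors r R k ω}, avgFibre r R k ω ∂Pc)
      ≤ Pc.real (ExactCross r R (k - 1))

/-- INPUT (hyperscaling-lite, level 2): touching two-cluster coexistence keeps positive probability at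
aspect `M`: `liminf_r P(N(r,Mr) = 2, K ≥ 1) > 0`. -/
def KissPos₂ (M : ℕ) : Prop :=
  ∃ c : ℝ, 0 < c ∧ ∃ r₀ : ℕ, ∀ r : ℕ, r₀ ≤ r →
    c ≤ Pc.real (ExactCross r (M * r) 2 ∩ {ω | 1 ≤ numDoors r (M * r) 2 ω})

/-- INPUT (shape): BOUNDED FIBRE at level 2 and aspect `M`: merging two touching crossing clusters through
a uniformly chosen contact creates, on average, `O(1)` fibre weight:
`E[avgFibre₂ ; N = 2, K ≥ 1] ≤ C · P(N = 2, K ≥ 1)` for all large `r`. -/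
def BoundedFibre₂ (M : ℕ) : Prop :=
  ∃ C : ℝ, ∃ r₀ : ℕ, ∀ r : ℕ, r₀ ≤ r →
    ∫ ω in ExactCross r (M * r) 2 ∩ {ω | 1 ≤ numDoors r (M * r) 2 ω}, avgFibre r (M * r) 2 ω ∂Pc ≤
      C * Pc.real (ExactCross r (M * r) 2 ∩ {ω | 1 ≤ numDoors r (M * r) 2 ω})

/-- THE DOOR ENGINE at level 2: `KissPos₂ M ∧ BoundedFibre₂ M → NP_M` (then `P(N = 1) ≥ (p/(1-p)) c/C`,
and `{N = 1}` is disjoint from `{N ≥ 2} = TwoShellClusters`). Provable now from `DoorBound`. -/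
def DoorEngine₂ : Prop := ∀ M : ℕ, 2 ≤ M → KissPos₂ M → BoundedFibre₂ M → NonProliferation M

/-- Transfer to the crux (gen-1 card `shell-product-kiss-positivity`, decl `NP_implies_crux`):
non-proliferation at any bounded aspect gives `U(1/6)` by the shell product. -/
def NP_implies_crux : Prop := (∃ M : ℕ, 2 ≤ M ∧ NonProliferation M) → NearLinearTwoClusterDecay

/-- The whole line of this card, level-2 form. -/
def DoorsLine : Prop :=
  DoorEngine₂ → NP_implies_crux → (∃ M : ℕ, 2 ≤ M ∧ KissPos₂ M ∧ BoundedFibre₂ M) → NearLinearTwoClusterDecay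

/-- `DoorsLine` is pure logic given its three hypotheses (checked). -/
theorem doorsLine_holds : DoorsLine := by
  intro hE hT ⟨M, hM, hK, hB⟩
  exact hT ⟨M, hM, hE M hM hK hB⟩

/-- Descent form from tightness: inputs at every level `2 ≤ k ≤ k₀` (touching `Touch_k`:
`P(N = k, K_k ≥ 1) ≥ c P(N = k)`, bounded fibre `E[avgFibre_k ; N=k, K_k ≥ 1] ≤ C P(N=k, K_k ≥ 1)`)
plus `Tight_M(k₀)`: `P(N ≤ k₀) ≥ c₀`, give `NP_M` by `k₀ - 1` applications of `DoorBound`. -/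
def Touch (M k : ℕ) : Prop :=
  ∃ c : ℝ, 0 < c ∧ ∃ r₀ : ℕ, ∀ r : ℕ, r₀ ≤ r →
    c * Pc.real (ExactCross r (M * r) k) ≤ Pc.real (ExactCross r (M * r) k ∩ {ω | 1 ≤ numDoors r (M * r) k ω})

def BoundedFibre (M k : ℕ) : Prop :=
  ∃ C : ℝ, ∃ r₀ : ℕ, ∀ r : ℕ, r₀ ≤ r →
    ∫ ω in ExactCross r (M * r) k ∩ {ω | 1 ≤ numDoors r (M * r) k ω}, avgFibre r (M * r) k ω ∂Pc ≤
      C * Pc.real (ExactCross r (M * r) k ∩ {ω | 1 ≤ numDoors r (M * r) k ω})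

def TightLaw (M k₀ : ℕ) : Prop :=
  ∃ c₀ : ℝ, 0 < c₀ ∧ ∃ r₀ : ℕ, ∀ r : ℕ, r₀ ≤ r →
    c₀ ≤ ∑ k ∈ Finset.range (k₀ + 1), Pc.real (ExactCross r (M * r) k)

def DoorDescent : Prop :=
  ∀ M k₀ : ℕ, 2 ≤ M → TightLaw M k₀ → (∀ k, 2 ≤ k → k ≤ k₀ → Touch M k ∧ BoundedFibre M k) →
    NonProliferation M

/-- Read-back: the crux in this file's vocabulary (outer radius general in `TwoBoxClusters` of gen 1;
here only the route decl is named). -/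
theorem crux_iff : NearLinearTwoClusterDecay ↔ NearLinearTwoClusterDecay := Iff.rfl

end

end Summit.CriticalPhenomena.PercolationContinuityZ3.Cruxes.NearLinearTwoClusterDecay.SketchDoors
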